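import Summits.NavierStokesRegularity.OSWSelfSimilar.SheetRPerturbedUniqueness
import HarnessLib

/-!
# SHEET-ℝ frame, (P1) for the FULL operator `A = (−∂² + d∂ + V) + K`: the pair solution operator of the realified `(A + σ)` under a
# Gårding bound for the PERTURBED form (cert-1's (S1) for `A_F = B_λ − P + F`)

HONEST FRAMING (cell ns-blowup GROUP B / zone Z3, case Z3-SR-SPEC, PAPER item (P1) «Lax–Milgram for `𝒜(σ) = A_F + σJ` on `E` from (S1)»,
SHEET-R-SPEC-PRICE-impl1 (S3); 1-D MODEL certificate frame (viscous gCLM/OSW sheet on the line); not Euler/NS; «violates: none — MODEL»).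
Nothing here asserts that a profile exists; `K : Esp L hL →L[ℝ] W L` is an arbitrary bounded real operator (for cert-1: `K = −P + F`, `P` the
non-local part `λχ + Ω̄H − aΩ̄′𝒰`, `F = θ(v₀, ·)_E v₀`), and the Gårding bound of the perturbed form — (S1)'s «`q_γ ≥ c₁W + c₂K′`», interval
arithmetic — is the HYPOTHESIS, bundled in `GardingDataK`.

* `GardingDataK` — coefficients of record + `‖v₁‖²_w + m‖v‖²_w ≤ linForm(v; v) + ∫ w K(jmap v)·v` on every compactly supported test;
* `coerciveK_shift` — for `s > −m` the perturbed shifted form is `κ(s)`-coercive on tests, `κ(s) = min(1, 4(m + s))`;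
* `Kpair`, `EformK2` — the perturbation on pairs and the perturbed pair form (bundled maps);
* `exists_pairSolutionOperatorK` — Lions on `WithLp 2 (Esp × Esp)`: the bounded linear pair solution operator of the realified
  `(A + σ)(u_R + iu_I) = g_R + ig_I`, `Re σ > −m`, with `‖S G‖ ≤ (4/κ)‖G‖` and the weak pair system WITH the `∫ w (Kp)φ` terms;
The choice `pairOpK σ`, its uniqueness (from `SheetRPerturbedUniqueness.pair_eq_zero_of_weakK`) and the complex packaging (`ℂ`-linearity,
resolvent identity, pseudo-resolvent) are the next file.  Two bundled maps and one hypothesis structure;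
no named fact.  WHAT THIS IS NOT: not NS; no number of record moves.
-/

noncomputable section

namespace Summit.NavierStokesRegularity.OSWSelfSimilar
namespace SheetRPerturbedPair

open _root_.MeasureTheory _root_.Set _root_.Filter _root_.Real SheetRWeakProfilePV SheetRWeakToStrong SheetREnergyClass SheetRWeightedMeasure
  SheetRLinearisedTests SheetREnergySpace SheetRTestSpace SheetRLinearisedFormBounds SheetRSolutionOperator SheetRLinearisedCutoffEnergy
  SheetRResolventPair SheetRComplexPivot SheetRResolventComplex SheetRPerturbedUniqueness Literature.Analysis.OperatorTheory
open scoped Topology ENNReal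

/-! ### §1 The hypothesis structure and the shifted perturbed form -/

/-- **Coefficient data with a Gårding bound for the PERTURBED form** `linForm(u; φ) + ∫ w (Kp) φ`: drift/potential of record and
`‖v₁‖²_w + m‖v‖²_w ≤ linForm(v; v) + ∫ w K(jmap v)·v` on every compactly supported odd energy-class test. [folklore] -/
structure GardingDataK (L : ℝ) (hL : 0 < L) (d V : ℝ → ℝ) (K : Esp L hL →L[ℝ] W L) (D₀ D₁ V₀ m : ℝ) : Prop where
  /-- `d` is a.e.-strongly measurable -/
  d_meas : AEStronglyMeasurable d volume
  /-- `V` is a.e.-strongly measurable -/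
  V_meas : AEStronglyMeasurable V volume
  /-- `D₀ ≥ 0` -/
  D₀_nonneg : 0 ≤ D₀
  /-- `D₁ ≥ 0` -/
  D₁_nonneg : 0 ≤ D₁
  /-- linear growth of the drift -/
  d_le : ∀ ξ, |d ξ| ≤ D₀ + D₁ * |ξ|
  /-- boundedness of the potential -/
  V_le : ∀ ξ, |V ξ| ≤ V₀
  /-- the Gårding lower bound for the perturbed form on compactly supported tests -/
  garding : ∀ vp : testSpace,
    (∫ ξ, (L ^ 2 + ξ ^ 2) * vp.1.2 ξ ^ 2) + m * ∫ ξ, (L ^ 2 + ξ ^ 2) * vp.1.1 ξ ^ 2 ≤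
      linForm L d V vp.1.1 vp.1.2 vp.1.1 vp.1.2 + ∫ y, (L ^ 2 + y ^ 2) * (((K (jmap hL vp) : W L) : ℝ → ℝ) y * vp.1.1 y)

variable {L D₀ D₁ V₀ m : ℝ} {d V : ℝ → ℝ} {hL : 0 < L} {K : Esp L hL →L[ℝ] W L}

/-- The underlying `GardingData`-free coefficient facts of the shift `V + s`. [folklore] -/
theorem shift_hypsK (h : GardingDataK L hL d V K D₀ D₁ V₀ m) (s : ℝ) :
    AEStronglyMeasurable (fun ξ => V ξ + s) volume ∧ ∀ ξ, |V ξ + s| ≤ V₀ + |s| :=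
  ⟨h.V_meas.add aestronglyMeasurable_const, fun ξ => (abs_add_le _ _).trans (add_le_add (h.V_le ξ) le_rfl)⟩

/-- **Coercivity of the shifted perturbed form on tests**: for `s > −m`,
`κ(s)‖jmap v‖² ≤ linForm L d (V + s) v v₁ v v₁ + ∫ w K(jmap v)·v`, `κ(s) = min(1, 4(m + s))`. [folklore] -/
theorem coerciveK_shift (h : GardingDataK L hL d V K D₀ D₁ V₀ m) {s : ℝ} (hs : -m < s) (vp : testSpace) :
    min 1 (4 * (m + s)) * ‖jmap hL vp‖ ^ 2 ≤
      linForm L d (fun ξ => V ξ + s) vp.1.1 vp.1.2 vp.1.1 vp.1.2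
        + ∫ y, (L ^ 2 + y ^ 2) * (((K (jmap hL vp) : W L) : ℝ → ℝ) y * vp.1.1 y) := by
  obtain ⟨hc, -, -, -⟩ := basic_of_isCompactTest vp.2
  obtain ⟨hwv, hwv₁⟩ := weighted_of_isCompactTest (L := L) vp.2
  obtain ⟨hint, -⟩ := abs_linForm_le hL h.d_meas h.V_meas h.D₁_nonneg h.d_le h.V_le vp.2 hc.aestronglyMeasurable vp.2.memLp.1 hwv hwv₁
  have hshift : linForm L d (fun ξ => V ξ + s) vp.1.1 vp.1.2 vp.1.1 vp.1.2 =
      linForm L d V vp.1.1 vp.1.2 vp.1.1 vp.1.2 + s * ∫ y, (L ^ 2 + y ^ 2) * vp.1.1 y ^ 2 := by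
    have hvv : Integrable (fun y => (L ^ 2 + y ^ 2) * (vp.1.1 y * vp.1.1 y)) :=
      hwv.congr (Eventually.of_forall fun y => by ring)
    unfold linForm
    rw [← integral_const_mul, ← integral_add hint (hwv.const_mul s)]
    refine integral_congr_ae (Eventually.of_forall fun y => ?_)
    ring
  rw [hshift, sq_norm_jmap]
  have hG := h.garding vp
  obtain ⟨hκ, hκ1⟩ := kappa_pos_le (m := m) hs
  have hκ4 : min 1 (4 * (m + s)) ≤ 4 * (m + s) := min_le_right _ _
  have hn0 : 0 ≤ ∫ ξ, (L ^ 2 + ξ ^ 2) * vp.1.1 ξ ^ 2 := integral_nonneg fun y => by positivity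
  have hn1 : 0 ≤ ∫ ξ, (L ^ 2 + ξ ^ 2) * vp.1.2 ξ ^ 2 := integral_nonneg fun y => by positivity
  nlinarith

/-! ### §2 The perturbation on pairs and the perturbed pair form -/

variable (hL) (K)

/-- `(p_R, p_I) ↦ (K p_R, K p_I)`. [folklore] -/
def Kpair : WithLp 2 (Esp L hL × Esp L hL) →L[ℝ] WithLp 2 (W L × W L) :=
  ((WithLp.prodContinuousLinearEquiv 2 ℝ (W L) (W L)).symm : (W L × W L) →L[ℝ] WithLp 2 (W L × W L)).comp
    ((K.comp (WithLp.fstL 2 ℝ (Esp L hL) (Esp L hL))).prod (K.comp (WithLp.sndL 2 ℝ (Esp L hL) (Esp L hL))))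

/-- Components of `Kpair`. [folklore] -/
theorem Kpair_fst_snd (P : WithLp 2 (Esp L hL × Esp L hL)) : (Kpair hL K P).fst = K P.fst ∧ (Kpair hL K P).snd = K P.snd := ⟨rfl, rfl⟩

/-- `‖Kpair P‖ ≤ ‖K‖‖P‖`. [folklore] -/
theorem norm_Kpair_le (P : WithLp 2 (Esp L hL × Esp L hL)) : ‖Kpair hL K P‖ ≤ ‖K‖ * ‖P‖ := by
  obtain ⟨h1, h2⟩ := Kpair_fst_snd hL K P
  have hsq : ‖Kpair hL K P‖ ^ 2 ≤ (‖K‖ * ‖P‖) ^ 2 := by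
    rw [WithLp.prod_norm_sq_eq_of_L2, h1, h2, mul_pow, WithLp.prod_norm_sq_eq_of_L2, mul_add]
    have a := K.le_opNorm P.fst
    have b := K.le_opNorm P.snd
    have ha : ‖K P.fst‖ ^ 2 ≤ (‖K‖ * ‖P.fst‖) ^ 2 := pow_le_pow_left₀ (norm_nonneg _) a 2
    have hb : ‖K P.snd‖ ^ 2 ≤ (‖K‖ * ‖P.snd‖) ^ 2 := pow_le_pow_left₀ (norm_nonneg _) b 2
    nlinarith
  nlinarith [norm_nonneg (Kpair hL K P), norm_nonneg K, norm_nonneg P, mul_nonneg (norm_nonneg K) (norm_nonneg P)]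

variable (hdm : AEStronglyMeasurable d volume) (hVm : AEStronglyMeasurable V volume)
  (hD₁ : 0 ≤ D₁) (hd : ∀ ξ, |d ξ| ≤ D₀ + D₁ * |ξ|) (hV : ∀ ξ, |V ξ| ≤ V₀) (t : ℝ)

/-- **The perturbed pair form**: `Eform2 + Pdata2 ∘ Kpair`, i.e.
`((p_R,p_I),(φ,ψ)) ↦ [Eform p_R φ − t·Bcpl p_I φ + Eform p_I ψ + t·Bcpl p_R ψ] + ∫w(Kp_R)φ + ∫w(Kp_I)ψ`. [folklore] -/
def EformK2 : WithLp 2 (Esp L hL × Esp L hL) →ₗ[ℝ] (testSpace × testSpace) →ₗ[ℝ] ℝ :=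
  Eform2 hL hdm hVm hD₁ hd hV t + (Pdata2 hL).comp ((Kpair hL K : WithLp 2 (Esp L hL × Esp L hL) →L[ℝ] WithLp 2 (W L × W L)) :
    WithLp 2 (Esp L hL × Esp L hL) →ₗ[ℝ] WithLp 2 (W L × W L))

/-- Unfolding `EformK2`. [folklore] -/
theorem EformK2_apply (P : WithLp 2 (Esp L hL × Esp L hL)) (Φ : testSpace × testSpace) :
    EformK2 hL K hdm hVm hD₁ hd hV t P Φ =
      (Eform hL hdm hVm hD₁ hd hV P.fst Φ.1 - t * Bcpl hL P.snd Φ.1 + Eform hL hdm hVm hD₁ hd hV P.snd Φ.2 + t * Bcpl hL P.fst Φ.2)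
        + (Pdata hL (K P.fst) Φ.1 + Pdata hL (K P.snd) Φ.2) := by
  rw [EformK2, LinearMap.add_apply, LinearMap.add_apply, Eform2_apply, LinearMap.comp_apply, ContinuousLinearMap.coe_coe, Pdata2_apply,
    (Kpair_fst_snd hL K P).1, (Kpair_fst_snd hL K P).2]

variable {hL K hdm hVm hD₁ hd hV t}

/-! ### §3 The perturbed pair solution operator -/

/-- **Existence (Lions on the product).**  Under `κ`-coercivity of the perturbed form on tests (`κ > 0`), there is a bounded linear
`S : WithLp 2 (W L × W L) →L[ℝ] WithLp 2 (Esp × Esp)` solving the perturbed pair system weakly: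
`linForm(u_R; v) + ∫w(Kp_R)v − t∫w u_I v = ∫w g_R v`, `linForm(u_I; v) + ∫w(Kp_I)v + t∫w u_R v = ∫w g_I v`, with
`‖S G‖ ≤ (4/κ)‖G‖`. [folklore] -/
theorem exists_pairSolutionOperatorK (hL : 0 < L) (K : Esp L hL →L[ℝ] W L) (hdm : AEStronglyMeasurable d volume)
    (hVm : AEStronglyMeasurable V volume) (hD₁ : 0 ≤ D₁) (hd : ∀ ξ, |d ξ| ≤ D₀ + D₁ * |ξ|) (hV : ∀ ξ, |V ξ| ≤ V₀) (t : ℝ) {κ : ℝ}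
    (hκ : 0 < κ)
    (hcoerK : ∀ vp : testSpace, κ * ‖jmap hL vp‖ ^ 2 ≤
      linForm L d V vp.1.1 vp.1.2 vp.1.1 vp.1.2 + ∫ y, (L ^ 2 + y ^ 2) * (((K (jmap hL vp) : W L) : ℝ → ℝ) y * vp.1.1 y)) :
    ∃ S : WithLp 2 (W L × W L) →L[ℝ] WithLp 2 (Esp L hL × Esp L hL),
      (∀ (G : WithLp 2 (W L × W L)) (v v₁ : ℝ → ℝ), IsCompactTest v v₁ →
        linForm L d V (prim (der (S G).fst)) (der (S G).fst) v v₁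
              + (∫ y, (L ^ 2 + y ^ 2) * (((K (S G).fst : W L) : ℝ → ℝ) y * v y))
              - t * ∫ y, (L ^ 2 + y ^ 2) * (prim (der (S G).snd) y * v y) = ∫ y, (L ^ 2 + y ^ 2) * ((G.fst : ℝ → ℝ) y * v y) ∧
          linForm L d V (prim (der (S G).snd)) (der (S G).snd) v v₁
              + (∫ y, (L ^ 2 + y ^ 2) * (((K (S G).snd : W L) : ℝ → ℝ) y * v y))
              + t * ∫ y, (L ^ 2 + y ^ 2) * (prim (der (S G).fst) y * v y) = ∫ y, (L ^ 2 + y ^ 2) * ((G.snd : ℝ → ℝ) y * v y)) ∧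
      ∀ G : WithLp 2 (W L × W L), ‖S G‖ ≤ 4 / κ * ‖G‖ := by
  haveI : CompleteSpace (Esp L hL) := completeSpace_Esp hL
  -- fixed-test bounds
  have hE : ∀ Φ : testSpace × testSpace, ∃ C : ℝ, ∀ P : WithLp 2 (Esp L hL × Esp L hL),
      |EformK2 hL K hdm hVm hD₁ hd hV t P Φ| ≤ C * ‖P‖ := by
    intro Φ
    obtain ⟨K₁, hK₁⟩ : ∃ C : ℝ, ∀ p : Esp L hL, |Eform hL hdm hVm hD₁ hd hV p Φ.1| ≤ C * ‖p‖ :=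
      ⟨_, fun p => by rw [Eform_apply]; exact (abs_linForm_profile_le hL hdm hVm hD₁ hd hV Φ.1 p).2⟩
    obtain ⟨K₂, hK₂⟩ : ∃ C : ℝ, ∀ p : Esp L hL, |Eform hL hdm hVm hD₁ hd hV p Φ.2| ≤ C * ‖p‖ :=
      ⟨_, fun p => by rw [Eform_apply]; exact (abs_linForm_profile_le hL hdm hVm hD₁ hd hV Φ.2 p).2⟩
    refine ⟨max K₁ 0 + |t| * (4 * ‖jmap hL Φ.1‖) + max K₂ 0 + |t| * (4 * ‖jmap hL Φ.2‖)
      + (2 * ‖K‖ * ‖jmap hL Φ.1‖ + 2 * ‖K‖ * ‖jmap hL Φ.2‖), fun P => ?_⟩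
    rw [EformK2_apply]
    have hf : ‖P.fst‖ ≤ ‖P‖ := WithLp.norm_fst_le (x := P)
    have hs : ‖P.snd‖ ≤ ‖P‖ := WithLp.norm_snd_le (x := P)
    have hb1 : |Eform hL hdm hVm hD₁ hd hV P.fst Φ.1| ≤ max K₁ 0 * ‖P‖ :=
      (hK₁ P.fst).trans ((mul_le_mul_of_nonneg_right (le_max_left _ _) (norm_nonneg _)).trans
        (mul_le_mul_of_nonneg_left hf (le_max_right _ _)))
    have hb2 : |Eform hL hdm hVm hD₁ hd hV P.snd Φ.2| ≤ max K₂ 0 * ‖P‖ :=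
      (hK₂ P.snd).trans ((mul_le_mul_of_nonneg_right (le_max_left _ _) (norm_nonneg _)).trans
        (mul_le_mul_of_nonneg_left hs (le_max_right _ _)))
    have h3 : |t * Bcpl hL P.snd Φ.1| ≤ |t| * (4 * ‖jmap hL Φ.1‖) * ‖P‖ := by
      rw [abs_mul, Bcpl_apply]
      have := (integrable_profile_mul_test hL P.snd Φ.1).2
      calc |t| * |∫ y, (L ^ 2 + y ^ 2) * (prim (der P.snd) y * Φ.1.1.1 y)| ≤ |t| * (4 * ‖P.snd‖ * ‖jmap hL Φ.1‖) :=
            mul_le_mul_of_nonneg_left this (abs_nonneg t)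
        _ ≤ |t| * (4 * ‖P‖ * ‖jmap hL Φ.1‖) := by gcongr
        _ = |t| * (4 * ‖jmap hL Φ.1‖) * ‖P‖ := by ring
    have h4 : |t * Bcpl hL P.fst Φ.2| ≤ |t| * (4 * ‖jmap hL Φ.2‖) * ‖P‖ := by
      rw [abs_mul, Bcpl_apply]
      have := (integrable_profile_mul_test hL P.fst Φ.2).2
      calc |t| * |∫ y, (L ^ 2 + y ^ 2) * (prim (der P.fst) y * Φ.2.1.1 y)| ≤ |t| * (4 * ‖P.fst‖ * ‖jmap hL Φ.2‖) :=
            mul_le_mul_of_nonneg_left this (abs_nonneg t)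
        _ ≤ |t| * (4 * ‖P‖ * ‖jmap hL Φ.2‖) := by gcongr
        _ = |t| * (4 * ‖jmap hL Φ.2‖) * ‖P‖ := by ring
    have h5 : |Pdata hL (K P.fst) Φ.1| ≤ 2 * ‖K‖ * ‖jmap hL Φ.1‖ * ‖P‖ := by
      refine (abs_Pdata_le hL (K P.fst) Φ.1).trans ?_
      have := K.le_opNorm P.fst
      calc 2 * ‖K P.fst‖ * ‖jmap hL Φ.1‖ ≤ 2 * (‖K‖ * ‖P‖) * ‖jmap hL Φ.1‖ := by gcongr; exact this.trans (by gcongr)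
        _ = 2 * ‖K‖ * ‖jmap hL Φ.1‖ * ‖P‖ := by ring
    have h6 : |Pdata hL (K P.snd) Φ.2| ≤ 2 * ‖K‖ * ‖jmap hL Φ.2‖ * ‖P‖ := by
      refine (abs_Pdata_le hL (K P.snd) Φ.2).trans ?_
      have := K.le_opNorm P.snd
      calc 2 * ‖K P.snd‖ * ‖jmap hL Φ.2‖ ≤ 2 * (‖K‖ * ‖P‖) * ‖jmap hL Φ.2‖ := by gcongr; exact this.trans (by gcongr)
        _ = 2 * ‖K‖ * ‖jmap hL Φ.2‖ * ‖P‖ := by ring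
    have hA : |Eform hL hdm hVm hD₁ hd hV P.fst Φ.1 - t * Bcpl hL P.snd Φ.1 + Eform hL hdm hVm hD₁ hd hV P.snd Φ.2 + t * Bcpl hL P.fst Φ.2|
        ≤ |Eform hL hdm hVm hD₁ hd hV P.fst Φ.1| + |t * Bcpl hL P.snd Φ.1| + |Eform hL hdm hVm hD₁ hd hV P.snd Φ.2|
            + |t * Bcpl hL P.fst Φ.2| :=
      (abs_add_le _ _).trans (add_le_add ((abs_add_le _ _).trans (add_le_add (abs_sub _ _) le_rfl)) le_rfl)
    have hB : |Pdata hL (K P.fst) Φ.1 + Pdata hL (K P.snd) Φ.2| ≤ |Pdata hL (K P.fst) Φ.1| + |Pdata hL (K P.snd) Φ.2| :=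
      abs_add_le _ _
    calc _ ≤ |Eform hL hdm hVm hD₁ hd hV P.fst Φ.1 - t * Bcpl hL P.snd Φ.1 + Eform hL hdm hVm hD₁ hd hV P.snd Φ.2 + t * Bcpl hL P.fst Φ.2|
          + |Pdata hL (K P.fst) Φ.1 + Pdata hL (K P.snd) Φ.2| := abs_add_le _ _
      _ ≤ (max K₁ 0 * ‖P‖ + |t| * (4 * ‖jmap hL Φ.1‖) * ‖P‖ + max K₂ 0 * ‖P‖ + |t| * (4 * ‖jmap hL Φ.2‖) * ‖P‖)
          + (2 * ‖K‖ * ‖jmap hL Φ.1‖ * ‖P‖ + 2 * ‖K‖ * ‖jmap hL Φ.2‖ * ‖P‖) := by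
          refine add_le_add (hA.trans ?_) (hB.trans (add_le_add h5 h6))
          gcongr
      _ = _ := by ring
  -- coercivity on the diagonal: cross terms cancel, K-terms are the hypothesis'
  have hcoer2 : ∀ Φ : testSpace × testSpace, κ * ‖jmap2 hL Φ‖ ^ 2 ≤ EformK2 hL K hdm hVm hD₁ hd hV t (jmap2 hL Φ) Φ := by
    intro Φ
    obtain ⟨h1, h2⟩ := jmap2_fst_snd hL Φ
    rw [EformK2_apply, h1, h2, Bcpl_jmap_symm hL Φ.2 Φ.1, Eform_jmap, Eform_jmap, (norm_jmap_le_norm_jmap2 hL Φ).1,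
      Pdata_apply, Pdata_apply]
    have hc1 := hcoerK Φ.1
    have hc2 := hcoerK Φ.2
    nlinarith
  have hP : ∀ (G : WithLp 2 (W L × W L)) (Φ : testSpace × testSpace), |Pdata2 hL G Φ| ≤ 4 * ‖G‖ * ‖jmap2 hL Φ‖ := by
    intro G Φ
    rw [Pdata2_apply]
    obtain ⟨-, hj1, hj2⟩ := norm_jmap_le_norm_jmap2 hL Φ
    have hf : ‖G.fst‖ ≤ ‖G‖ := WithLp.norm_fst_le (x := G)
    have hs : ‖G.snd‖ ≤ ‖G‖ := WithLp.norm_snd_le (x := G)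
    have h1 := abs_Pdata_le hL G.fst Φ.1
    have h2 := abs_Pdata_le hL G.snd Φ.2
    calc |Pdata hL G.fst Φ.1 + Pdata hL G.snd Φ.2| ≤ |Pdata hL G.fst Φ.1| + |Pdata hL G.snd Φ.2| := abs_add_le _ _
      _ ≤ 2 * ‖G.fst‖ * ‖jmap hL Φ.1‖ + 2 * ‖G.snd‖ * ‖jmap hL Φ.2‖ := add_le_add h1 h2
      _ ≤ 2 * ‖G‖ * ‖jmap2 hL Φ‖ + 2 * ‖G‖ * ‖jmap2 hL Φ‖ := by gcongr
      _ = 4 * ‖G‖ * ‖jmap2 hL Φ‖ := by ring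
  obtain ⟨S, hS, hSn⟩ := exists_solutionOperator_of_coercive (F := WithLp 2 (Esp L hL × Esp L hL)) (jmap2 hL)
    (fun Φ => ‖jmap2 hL Φ‖) (fun _ => norm_nonneg _) (C := 1) zero_le_one (fun Φ => by rw [one_mul])
    (EformK2 hL K hdm hVm hD₁ hd hV t) hE hκ hcoer2 (Pdata2 hL) (CP := 4) (by norm_num) hP
  refine ⟨S, fun G v v₁ hv => ?_, fun G => ?_⟩
  · have h1 := hS G (⟨(v, v₁), hv⟩, 0)
    have h2 := hS G (0, ⟨(v, v₁), hv⟩)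
    rw [EformK2_apply, Pdata2_apply] at h1 h2
    simp only [map_zero, mul_zero, add_zero, sub_zero, zero_add] at h1 h2
    rw [Eform_apply, Bcpl_apply, Pdata_apply, Pdata_apply] at h1 h2
    exact ⟨by linarith, by linarith⟩
  · calc ‖S G‖ ≤ 4 * (1 / κ) * ‖G‖ := hSn G
      _ = 4 / κ * ‖G‖ := by ring

end SheetRPerturbedPair
end Summit.NavierStokesRegularity.OSWSelfSimilar

end
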